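import Summits.QuantumFields.YangMills.Theorems.BalabanUVNodesN15BackgroundEntry2Letters
import Summits.QuantumFields.YangMills.Theorems.BalabanUVNodesN15TwoGridHolderStepsDiv
import Summits.QuantumFields.YangMills.Theorems.BalabanUVNodesN15FullPropagatorBackwardEntry
import Summits.QuantumFields.YangMills.Theorems.BalabanUVNodesN15BackgroundV1Gauge
import HarnessLib

/-!
# Route «BalabanUVNodes» (K4 «SpineRates»), node N15 = NE2, BACKGROUND LAYER — THE ENTRY-2 DEVICE AT BAŁABAN's FULL `U ≡ 1` PROPAGATOR, part 1: the symbol ∕ calculus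
# bridges, the FORWARD shift (cost `e^{ρ}`, two-grid defect majorised by the one-step forward difference), and THE SHIFT-DEFECT ROW LETTER
# `𝔇(S′_{+κ}, S_{+κ})∘(C_a∘Σ_ν(G∇_ν*)pr_ν) ≤ C·(o₁ + a₀(L^k)^{−α})·e^{−δ|y−y′|_T}` — HYPOTHESIS-FREE in the `U ≡ 1` inputs

Cell `pub-ymgap`, seat `pub-ymgap-dag-n15-c` (generation g8; R134 ACCELERATION SEAT, strategy s1; HUMAN RULING D-0062; chair R424 venue; `bears_on: R4∕N15`).  Filed
`--kind proof --supports stmt-QuantumFields-20509 --as helper` (K3⁶; count-neutral).  Imports BY NAME this seat's `…N15BackgroundEntry2Letters` (`sumJ`, `fgrad`, `fgradAdj`,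
`hasMaj_sumJ_exp`, `linearMap_comp_sum`, S2's helpers), dag-n15-a part 66 `…TwoGridHolderStepsDiv` (`hasMaj_divSteps_pair`: the Hölder steps of `G∇*`, [B4-I] (1.111) tensor clause;
through it part 42 `ineq110_114_pair` ∕ `hasMaj_gDivAdj_of_ineq`, part 33 `symbOp` ∕ `sT` ∕ `sTinv` ∕ `sD`, part 39 `gOp`), this seat's g7 G5 `…FullPropagatorBackwardEntry` (→ part 59
`hasMaj_rate_mono`, W1 `kingPr_add_unitVec` ∕ `tdistT_blockOf_sub_unitVec_le` ∕ `hasMaj_pull_comp` ∕ `bshiftV`), g3 `…BackgroundV1Gauge` (`bshiftEquiv`), [B6] `B9Eq3130MatrixLetters`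
(`hasMaj_id_ofBlocks`); nothing in the tree is modified.

WHY.  `…Entry2Letters.hasMaj_idef_entry2_of_letters` reduces the η-defect of the by-parts dressed entry 2 to natural letters plus ONE genuinely two-grid letter: the defect of the
fine one-step shift against the coarse one, composed with a coefficient operator and the divergence-type source `Σ = Σ_ν (G∇_ν*) pr_ν`.  THIS FILE proves that letter for
Bałaban's full `U ≡ 1` Landau-gauge propagator `G = gOp` on the torus family of record (`M_μ = 2L^{m_T}`, spacings `L^{−k}` ∕ `L^{−m−k}`, King's pairing), for ANY coefficient operator
intertwining the coarse shift (`S_{+κ}C_a = C_a⁺S_{+κ}`, `C_a ≤ diagK a₀`, `C_a⁺ − C_a ≤ diagK o₁`): through King's pairing the defect of the two forward shifts VANISHES on the upper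
block face and is (minus) the one-step forward difference inside (§3, the forward twin of this seat's W1 device), and `(S_{+κ} − 1)C_aΣ = (C_a⁺ − C_a)S_{+κ}Σ + C_a(S_{+κ} − 1)Σ`: the
first term costs the oscillation letter `o₁` (times the (1.110) majorant of `G∇*` and the shift cost `e^{δ}`), the second the HÖLDER STEP of `G∇*` — dag-n15-a part 66 at `j = 1`
(`≤ C(1∕L^k)^α e^{−δd}` when `4 ≤ L^k`; for `L^k < 4` the plain majorant twice, the rate absorbed by `4^α`, as in G5).  No mixed piece `∇G∇*` anywhere.

CONTENTS ([folklore] bookkeeping + the two cited inputs; 0 def).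
* §1 bridges: `symbOp_sT_eq_pull` (`ρ(s_κ) = pull (bshiftEquiv κ)`), `bshiftV_eq_pull_symm`, ★ `symbOp_sTinv_sub_one_eq` (Bałaban's `∇_ν* = ρ(n(s_ν⁻¹ − 1))` IS
  `fgradAdj n (bshiftEquiv ν)`), `symbOp_sD_eq` (`∇_ν = fgrad n (bshiftEquiv ν)`), `symbOp_sT_sub_one_eq`.
* §2 `tdistT_blockOf_add_unitVec_le`, `hasMaj_fshift_comp` (cost `e^{ρ}`), `hasMaj_fshift`.
* §3 `kingPrV_add` (pairing dichotomy one step forward), `idef_fshift_apply`, ★ `hasMaj_idefFShift_comp`.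
* §4 ★ `hasMaj_oneStepFwd_gDivAdj` (`(S_{+κ} − 1)∘G∘∇_ν* ≤ C(L^k)^{−α}e^{−δd}`, hypothesis-free), `comp_sumJ`, `sub_id_comp_comp_eq`, ★★ **`hasMaj_shiftDefect_fullG`**.

HONEST FRAMING ∕ LIMITS.  `U ≡ 1` torus family at fixed coupling `b`; the coefficient operator and its letters are DISPLAYED (the species' business); constants crude and ours; one
more letter of the located knit — not a (3.42) entry, not a node face.  NE2⁺ NOT PRINTED, NOT proved, not claimed; count-neutral (typed 28∕28 · discharged 5∕27 of record
unchanged); N15 NOT discharged; one finite T⁴ at fixed ε — NOT ℝ⁴, NOT infinite volume, NOT OS, NOT a mass gap, NOT Clay.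
-/

noncomputable section

open scoped BigOperators
open Finset

namespace Summit.QuantumFields.YangMills.BalabanUVNodes.N15.BackgroundLayer

open Literature.MathematicalPhysics.QuantumFieldTheory.Balaban1983to89
open Literature.MathematicalPhysics.QuantumFieldTheory.Balaban1983to89.B11SectG (BlockNorm HasMaj RowSum hasMaj_comp hasMaj_comp_exp)
open Literature.MathematicalPhysics.QuantumFieldTheory.Balaban1983to89.T4EtaRateDefect (idef idef_apply idef_comp idef_add)
open Literature.MathematicalPhysics.QuantumFieldTheory.Balaban1983to89.T4EtaRateCoeffDefect (pull pull_apply diagK diagK_nonneg)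
open Literature.MathematicalPhysics.QuantumFieldTheory.Balaban1983to89.B6RandomWalk (Triangle254)
open Literature.MathematicalPhysics.QuantumFieldTheory.Balaban1983to89.B11AxialTransport190 (abs_le_loc_ofBlocks loc_ofBlocks_le)
open Literature.MathematicalPhysics.QuantumFieldTheory.Balaban1983to89.B9Eq3130MatrixLetters (hasMaj_id_ofBlocks)
open Literature.MathematicalPhysics.QuantumFieldTheory.Balaban1983to89.B5Prop11Plancherel (Tor fine unitVec)
open Literature.MathematicalPhysics.QuantumFieldTheory.Balaban1983to89.B5SiteBridgeP12 (MP)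
open Literature.MathematicalPhysics.QuantumFieldTheory.Balaban1983to89.B6UnitTorusCarrier (unitTorusGeo triangle254_unitTorusGeo rowSum_unitTorusGeo)
open Literature.MathematicalPhysics.QuantumFieldTheory.King1986.Torus (blockOf tdistT tdistT_nonneg tdistT_self tdistT_symm tdistT_triangle)
open Summit.QuantumFields.YangMills.BalabanUVNodes.N15.MatrixSpecies (liftMap liftBlk)
open Summit.QuantumFields.YangMills.BalabanUVNodes.N15.BackgroundModel (kappa_ofBlocks)
open Summit.QuantumFields.YangMills.BalabanUVNodes.N15.SiteLayer (hasMaj_exp_comp_diagK hasMaj_diagK_comp_exp hasMaj_add_exp hasMaj_exp_mono)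
open Summit.QuantumFields.YangMills.BalabanUVNodes.N15.TwoGrid (gOp symbOp sT sTinv sD symbOp_single_apply hasMaj_divSteps_pair ineq110_114_pair
  hasMaj_gDivAdj_of_ineq paramsOf hasMaj_rate_mono)
open Summit.QuantumFields.YangMills.BalabanUVNodes.N15.VectorPiece (blkFine kingPrV kingPrV_eq blkFine_comp_kingPrV bshiftV bshiftV_apply bshiftEquiv bshiftEquiv_apply
  bshiftEquiv_symm_apply kingPr_add_unitVec blockOf_sub_unitVec tdistT_blockOf_sub_unitVec_le hasMaj_pull_comp)

variable {d : ℕ}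

/-! ## §1 Bridges: the lineage's symbol operators are the abstract difference quotients of `…TupleCalculus` at the translation `bshiftEquiv` -/

section Bridges

variable (M : Fin (d + 1) → ℕ) (n : ℕ)

/-- the one-step FORWARD shift `ρ(s_κ)` is the pull-back along the translation `(x, a) ↦ (x + e_κ, a)`. [folklore] -/
theorem symbOp_sT_eq_pull (κ : Fin (d + 1)) : symbOp M n (sT M n κ) = pull ⇑(bshiftEquiv M n κ) := by
  refine LinearMap.ext fun f => funext fun i => ?_
  rw [sT, symbOp_single_apply, one_mul, pull_apply, bshiftEquiv_apply]

/-- the BACKWARD shift `S_{−κ}` is the pull-back along the inverse translation. [folklore] -/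
theorem bshiftV_eq_pull_symm (κ : Fin (d + 1)) : bshiftV M n κ = pull ⇑(bshiftEquiv M n κ).symm := by
  refine LinearMap.ext fun f => funext fun i => ?_
  rw [bshiftV_apply, pull_apply, bshiftEquiv_symm_apply]

/-- Bałaban's `∇_ν* = ρ(n(s_ν⁻¹ − 1))` IS `fgradAdj n (bshiftEquiv ν)`. [cite: Balaban1984PropagatorsI, (1.3) p.18 (the lattice derivative: shape)] -/
theorem symbOp_sTinv_sub_one_eq (ν : Fin (d + 1)) :
    symbOp M n ((n : ℝ) • (sTinv M n ν - 1)) = fgradAdj (n : ℝ) (bshiftEquiv M n ν) := by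
  refine LinearMap.ext fun f => funext fun i => ?_
  rw [map_smul, map_sub, map_one, LinearMap.smul_apply, LinearMap.sub_apply, Pi.smul_apply, Pi.sub_apply, sTinv, symbOp_single_apply, one_mul,
    fgradAdj_apply, bshiftEquiv_symm_apply, smul_eq_mul, ← sub_eq_add_neg]
  rfl

/-- Bałaban's `∇_ν = ρ(n(s_ν − 1))` IS `fgrad n (bshiftEquiv ν)`. [cite: Balaban1984PropagatorsI, (1.3) p.18 (shape)] -/
theorem symbOp_sD_eq (ν : Fin (d + 1)) : symbOp M n (sD M n ν (n : ℝ)) = fgrad (n : ℝ) (bshiftEquiv M n ν) := by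
  refine LinearMap.ext fun f => funext fun i => ?_
  rw [sD, map_smul, map_sub, map_one, LinearMap.smul_apply, LinearMap.sub_apply, Pi.smul_apply, Pi.sub_apply, sT, symbOp_single_apply, one_mul,
    fgrad_apply, bshiftEquiv_apply, smul_eq_mul]
  rfl

/-- `ρ(s_κ − 1) = pull e_κ − 1`. [folklore] -/
theorem symbOp_sT_sub_one_eq (κ : Fin (d + 1)) :
    symbOp M n (sT M n κ - 1) = pull ⇑(bshiftEquiv M n κ) - LinearMap.id := by
  rw [map_sub, map_one, symbOp_sT_eq_pull]
  rfl

end Bridges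

/-! ## §2 The forward shift costs a factor `e^{ρ}` -/

section Forward

variable {L : ℕ} (M : Fin (d + 1) → ℕ) [∀ μ, NeZero (M μ)] (k n : ℕ) [NeZero n]

/-- `|B(x + e_κ) − B(x)|_T ≤ 1`. [folklore] -/
theorem tdistT_blockOf_add_unitVec_le (x : Tor (fine n M)) (κ : Fin (d + 1)) :
    tdistT M (blockOf n M (x + unitVec (fine n M) κ)) (blockOf n M x) ≤ 1 := by
  have h := tdistT_blockOf_sub_unitVec_le n M (x + unitVec (fine n M) κ) κ
  rw [add_sub_cancel_right, tdistT_symm] at h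
  exact h

/-- **THE FORWARD SHIFT COSTS A FACTOR `e^{ρ}`**: if `T` has the block majorant `B·e^{−ρ|y−y′|_T}` (`B, ρ ≥ 0`) into the level-`n` bonds blocked by unit blocks, then `S_{+κ}∘T` has
`B·e^{ρ}·e^{−ρ|y−y′|_T}` (the forward twin of this seat's W1 `hasMaj_bshiftV_comp`). [cite: Balaban1984PropagatorsII, (2.52)–(2.55) pp.232–233 (block-majorant bookkeeping, shape)] -/
theorem hasMaj_fshift_comp {F₁ : Type} [AddCommGroup F₁] [Module ℝ F₁] {b₁ : BlockNorm (unitTorusGeo L k M) F₁}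
    {T : F₁ →ₗ[ℝ] (Tor (fine n M) × Fin (d + 1) → ℝ)} {B ρ : ℝ} (hB : 0 ≤ B) (hρ : 0 ≤ ρ) (κ : Fin (d + 1))
    (h : HasMaj b₁ (BlockNorm.ofBlocks (unitTorusGeo L k M) (fun i : Tor (fine n M) × Fin (d + 1) => blockOf n M i.1)) T
      (fun y y' => B * Real.exp (-(ρ * tdistT M y y')))) :
    HasMaj b₁ (BlockNorm.ofBlocks (unitTorusGeo L k M) (fun i : Tor (fine n M) × Fin (d + 1) => blockOf n M i.1)) (pull ⇑(bshiftEquiv M n κ) ∘ₗ T)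
      (fun y y' => B * Real.exp ρ * Real.exp (-(ρ * tdistT M y y'))) := by
  refine hasMaj_pull_comp (g := unitTorusGeo L k M) (fun i : Tor (fine n M) × Fin (d + 1) => blockOf n M i.1) ⇑(bshiftEquiv M n κ)
    (fun _ _ => mul_nonneg (mul_nonneg hB (Real.exp_nonneg _)) (Real.exp_nonneg _)) (fun i y' => ?_) h
  show B * Real.exp (-(ρ * tdistT M (blockOf n M (bshiftEquiv M n κ i).1) y')) ≤ B * Real.exp ρ * Real.exp (-(ρ * tdistT M (blockOf n M i.1) y'))
  rw [bshiftEquiv_apply, mul_assoc, ← Real.exp_add]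
  refine mul_le_mul_of_nonneg_left (Real.exp_le_exp.mpr ?_) hB
  have h1 := tdistT_triangle M (blockOf n M i.1) (blockOf n M (i.1 + unitVec (fine n M) κ)) y'
  have h2 : tdistT M (blockOf n M i.1) (blockOf n M (i.1 + unitVec (fine n M) κ)) ≤ 1 := by
    rw [tdistT_symm]; exact tdistT_blockOf_add_unitVec_le M n i.1 κ
  nlinarith

/-- **THE FORWARD SHIFT ITSELF** `S_{+κ} ≤ e^{ρ}·e^{−ρ|y−y′|_T}` between the sharp unit-block norms (`ρ ≥ 0`). [folklore] -/
theorem hasMaj_fshift {ρ : ℝ} (hρ : 0 ≤ ρ) (κ : Fin (d + 1)) :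
    HasMaj (BlockNorm.ofBlocks (unitTorusGeo L k M) (fun i : Tor (fine n M) × Fin (d + 1) => blockOf n M i.1))
      (BlockNorm.ofBlocks (unitTorusGeo L k M) (fun i : Tor (fine n M) × Fin (d + 1) => blockOf n M i.1)) (pull ⇑(bshiftEquiv M n κ))
      (fun y y' => Real.exp ρ * Real.exp (-(ρ * tdistT M y y'))) := by
  have h := hasMaj_fshift_comp M k n zero_le_one hρ κ
    (hasMaj_id_ofBlocks (g := unitTorusGeo L k M) (fun i : Tor (fine n M) × Fin (d + 1) => blockOf n M i.1) (fun y => tdistT_self M y) ρ)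
  rw [LinearMap.comp_id] at h
  exact h.mono fun y y' => le_of_eq (by ring)

end Forward

/-! ## §3 The defect of the two forward shifts through King's pairing is majorised by the one-step forward difference -/

section Device

variable {L : ℕ} [NeZero L] (M : Fin (d + 1) → ℕ) [∀ μ, NeZero (M μ)] (k m : ℕ)

/-- The bond pairing one step FORWARD: `prV(x′ + e′_κ, a)` is `prV(x′, a)` (inside the block) or `(pr x′ + e_κ, a)` (on the upper `κ`-face). [cite: King1986, p.664 (pairing convention)] -/
theorem kingPrV_add (i : Tor (fine (L ^ m * L ^ k) M) × Fin (d + 1)) (κ : Fin (d + 1)) :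
    kingPrV L k m M (i.1 + unitVec (fine (L ^ m * L ^ k) M) κ, i.2) = kingPrV L k m M i ∨
      kingPrV L k m M (i.1 + unitVec (fine (L ^ m * L ^ k) M) κ, i.2) =
        ((kingPrV L k m M i).1 + unitVec (fine (L ^ k) M) κ, (kingPrV L k m M i).2) := by
  rw [kingPrV_eq, kingPrV_eq, kingPr_add_unitVec]
  by_cases h : L ^ m ∣ (i.1 κ).val + 1
  · rw [if_pos h]; exact Or.inr rfl
  · rw [if_neg h]; exact Or.inl rfl

omit [NeZero L] [∀ μ, NeZero (M μ)] in
/-- THE DEFECT OF THE TWO FORWARD SHIFTS, pointwise: `𝔇(S′_{+κ}, S_{+κ})g (x′, a) = g(prV(x′ + e′_κ, a)) − g(pr x′ + e_κ, a)`. [folklore] -/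
theorem idef_fshift_apply (κ : Fin (d + 1)) (g : Tor (fine (L ^ k) M) × Fin (d + 1) → ℝ) (i : Tor (fine (L ^ m * L ^ k) M) × Fin (d + 1)) :
    idef (pull (kingPrV L k m M)) (pull (kingPrV L k m M)) (pull ⇑(bshiftEquiv M (L ^ m * L ^ k) κ)) (pull ⇑(bshiftEquiv M (L ^ k) κ)) g i =
      g (kingPrV L k m M (i.1 + unitVec (fine (L ^ m * L ^ k) M) κ, i.2)) -
        g ((kingPrV L k m M i).1 + unitVec (fine (L ^ k) M) κ, (kingPrV L k m M i).2) := rfl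

/-- **THE DEFECT OF THE TWO FORWARD SHIFTS IS MAJORISED BY THE ONE-STEP FORWARD DIFFERENCE** (forward twin of W1 `hasMaj_idefShift_comp`): through King's bond pairing,
`𝔇(S′_{+κ}, S_{+κ})∘T` has every block majorant `K ≥ 0` that `(S_{+κ} − 1)∘T` has — the defect VANISHES on the upper `κ`-face of the block and is (minus) the one-step forward
difference inside it. [cite: King1986, p.664 (pairing convention «x′ ∈ B^n(x)»: the mechanism)] -/
theorem hasMaj_idefFShift_comp {F₁ : Type} [AddCommGroup F₁] [Module ℝ F₁] {b₁ : BlockNorm (unitTorusGeo L k M) F₁}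
    {T : F₁ →ₗ[ℝ] (Tor (fine (L ^ k) M) × Fin (d + 1) → ℝ)} {K : (unitTorusGeo L k M).Site → (unitTorusGeo L k M).Site → ℝ} (hK : ∀ y y', 0 ≤ K y y')
    (κ : Fin (d + 1))
    (h : HasMaj b₁ (BlockNorm.ofBlocks (unitTorusGeo L k M) (blkFine L k M)) ((pull ⇑(bshiftEquiv M (L ^ k) κ) - LinearMap.id) ∘ₗ T) K) :
    HasMaj b₁ (BlockNorm.ofBlocks (unitTorusGeo L k M) (blkFine L k M ∘ kingPrV L k m M))
      (idef (pull (kingPrV L k m M)) (pull (kingPrV L k m M)) (pull ⇑(bshiftEquiv M (L ^ m * L ^ k) κ)) (pull ⇑(bshiftEquiv M (L ^ k) κ)) ∘ₗ T) K := by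
  intro y' μ hμ y
  refine loc_ofBlocks_le _ _ (mul_nonneg (hK y y') (b₁.loc_nonneg y' μ)) fun i hi => ?_
  rw [LinearMap.comp_apply, idef_fshift_apply]
  rcases kingPrV_add M k m i κ with hc | hc
  · -- inside the block: (minus) the one-step forward difference at the paired bond
    rw [hc]
    have hval : T μ (kingPrV L k m M i) - T μ ((kingPrV L k m M i).1 + unitVec (fine (L ^ k) M) κ, (kingPrV L k m M i).2) =
        -((((pull ⇑(bshiftEquiv M (L ^ k) κ) - LinearMap.id) ∘ₗ T : F₁ →ₗ[ℝ] (Tor (fine (L ^ k) M) × Fin (d + 1) → ℝ)) μ) (kingPrV L k m M i)) := by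
      rw [LinearMap.comp_apply, LinearMap.sub_apply, Pi.sub_apply, pull_apply, bshiftEquiv_apply, LinearMap.id_apply, neg_sub]
    rw [hval, abs_neg]
    have hi' : blkFine L k M (kingPrV L k m M i) = y := hi
    exact (abs_le_loc_ofBlocks (g := unitTorusGeo L k M) (blkFine L k M) _ hi').trans (h y' μ hμ y)
  · -- on the upper face: the two shifts are paired, the defect vanishes
    rw [hc, sub_self, abs_zero]
    exact mul_nonneg (hK y y') (b₁.loc_nonneg y' μ)

end Device

/-! ## §4 The one-step forward difference of `G∇_ν*` and THE SHIFT-DEFECT LETTER at Bałaban's full `U ≡ 1` propagator -/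

section FullG

variable {L : ℕ} [NeZero L]

/-- **THE ONE-STEP FORWARD DIFFERENCE OF `G∇_ν*` ON THE COARSE GRID**: for odd `L ≥ 3`, `b > 0`, `0 ≤ α < 1` there are `δ, C > 0` with, on the torus family of record,
`(S_{+κ} − 1)∘G∘∇_ν* ≤ C·(L^k)^{−α}·e^{−δ|y−y′|_T}` between the sharp unit-block norms — dag-n15-a part 66's Hölder step of the tensor clause (1.111) at `j = 1` when `4 ≤ L^k`, else
the (1.110) majorant of `G∇_ν*` twice (`(1∕L^k)^α > 4^{−α}`). [cite: Balaban1984PropagatorsI, Prop. 1.2 (1.110)–(1.111) p.35; King1986, p.664 (pairing)] -/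
theorem hasMaj_oneStepFwd_gDivAdj (hLodd : Odd L) (hL2 : 2 ≤ L) {b : ℝ} (hb : 0 < b) {α : ℝ} (hα0 : 0 ≤ α) (hα1 : α < 1) :
    ∃ δ C : ℝ, 0 < δ ∧ 0 < C ∧ ∀ (mT k m : ℕ) (_hk : 1 ≤ k) (hL : Odd L ∧ 1 < L) (κ ν : Fin (d + 1)),
      HasMaj (BlockNorm.ofBlocks (unitTorusGeo L k (MP (paramsOf d L mT k hL))) (blkFine L k (MP (paramsOf d L mT k hL))))
        (BlockNorm.ofBlocks (unitTorusGeo L k (MP (paramsOf d L mT k hL))) (blkFine L k (MP (paramsOf d L mT k hL))))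
        ((pull ⇑(bshiftEquiv (MP (paramsOf d L mT k hL)) (L ^ k) κ) - LinearMap.id) ∘ₗ
          (gOp (MP (paramsOf d L mT k hL)) (L ^ k) b ∘ₗ fgradAdj ((L ^ k : ℕ) : ℝ) (bshiftEquiv (MP (paramsOf d L mT k hL)) (L ^ k) ν)))
        (fun y y' => C * ((L ^ k : ℕ) : ℝ) ^ (-α) * Real.exp (-(δ * tdistT (MP (paramsOf d L mT k hL)) y y'))) := by
  have hL : Odd L ∧ 1 < L := ⟨hLodd, by omega⟩
  have hL0 : 0 < L := by omega
  obtain ⟨δ₁, C₁, hδ₁, hC₁, HH⟩ := hasMaj_divSteps_pair (d := d) hL hb hα0 hα1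
  obtain ⟨δ₀, C₀, Cα, Cε, Cαε, hδ₀, hC₀, HP⟩ := ineq110_114_pair (d := d) hL hb
  set δ : ℝ := min δ₀ δ₁ with hδdef
  have hδ : 0 < δ := lt_min hδ₀ hδ₁
  set C : ℝ := C₁ + C₀ * (1 + Real.exp δ) * (4 : ℝ) ^ α with hCdef
  have h4α : (1 : ℝ) ≤ (4 : ℝ) ^ α := Real.one_le_rpow (by norm_num) hα0
  have hC : 0 < C := by positivity
  refine ⟨δ, C, hδ, hC, fun mT k m hk hL' κ ν => ?_⟩
  have hproof : hL' = hL := rfl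
  set M : Fin (d + 1) → ℕ := MP (paramsOf d L mT k hL') with hM
  have hn1 : 1 ≤ L ^ k := Nat.one_le_pow _ _ hL0
  have hnr : (1 : ℝ) ≤ ((L ^ k : ℕ) : ℝ) := by exact_mod_cast hn1
  have hnpos : (0 : ℝ) < ((L ^ k : ℕ) : ℝ) := by linarith
  have hrα : 0 ≤ ((L ^ k : ℕ) : ℝ) ^ (-α) := Real.rpow_nonneg hnpos.le _
  -- the operator in the lineage's symbol form
  rw [← symbOp_sTinv_sub_one_eq, ← symbOp_sT_sub_one_eq]
  -- the (1.110) majorant of `G∇_ν*` at the common rate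
  obtain ⟨HP1, -⟩ := HP mT k m hk
  have hS : HasMaj (BlockNorm.ofBlocks (unitTorusGeo L k M) (blkFine L k M)) (BlockNorm.ofBlocks (unitTorusGeo L k M) (blkFine L k M))
      (gOp M (L ^ k) b ∘ₗ symbOp M (L ^ k) (((L ^ k : ℕ) : ℝ) • (sTinv M (L ^ k) ν - 1))) (fun y y' => C₀ * Real.exp (-(δ * tdistT M y y'))) :=
    hasMaj_rate_mono hC₀.le (min_le_left δ₀ δ₁) (hasMaj_gDivAdj_of_ineq M k (L ^ k) b hn1 HP1 hC₀.le ν)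
  by_cases h4 : 4 ≤ L ^ k
  · -- Hölder step at `j = 1`
    obtain ⟨H1, -⟩ := HH mT k m hk κ ν 1
    have hstep := hasMaj_rate_mono (mul_nonneg hC₁.le (Real.rpow_nonneg (by positivity) _)) (min_le_right δ₀ δ₁) (H1 (by omega))
    rw [pow_one, ← LinearMap.comp_assoc] at hstep
    rw [← LinearMap.comp_assoc]
    refine hstep.mono fun y y' => ?_
    have hE := Real.exp_nonneg (-(δ * tdistT M y y'))
    have hq : (((1 : ℕ) : ℝ) / ((L ^ k : ℕ) : ℝ)) ^ α = ((L ^ k : ℕ) : ℝ) ^ (-α) := by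
      rw [Nat.cast_one, one_div, Real.inv_rpow hnpos.le, Real.rpow_neg hnpos.le]
    rw [hq]
    have hle : C₁ * ((L ^ k : ℕ) : ℝ) ^ (-α) ≤ C * ((L ^ k : ℕ) : ℝ) ^ (-α) := by
      rw [hCdef]
      have h0 : 0 ≤ C₀ * (1 + Real.exp δ) * (4 : ℝ) ^ α * ((L ^ k : ℕ) : ℝ) ^ (-α) := by positivity
      nlinarith
    exact mul_le_mul_of_nonneg_right hle hE
  · -- small `L^k`: the plain majorant twice, the rate absorbed by `4^α`
    have h4' : ((L ^ k : ℕ) : ℝ) < 4 := by exact_mod_cast (show L ^ k < 4 by omega)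
    have hSh := hasMaj_fshift_comp M k (L ^ k) (b₁ := BlockNorm.ofBlocks (unitTorusGeo L k M) (blkFine L k M)) hC₀.le hδ.le κ hS
    rw [symbOp_sT_sub_one_eq, LinearMap.sub_comp, LinearMap.id_comp]
    refine (hSh.sub hS).mono fun y y' => ?_
    have hE := Real.exp_nonneg (-(δ * tdistT M y y'))
    have hrate : (1 : ℝ) ≤ (4 : ℝ) ^ α * ((L ^ k : ℕ) : ℝ) ^ (-α) := by
      rw [Real.rpow_neg hnpos.le, ← Real.inv_rpow hnpos.le, ← Real.mul_rpow (by norm_num) (inv_nonneg.mpr hnpos.le)]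
      refine Real.one_le_rpow ?_ hα0
      rw [le_mul_inv_iff₀ hnpos]; linarith
    have hle : C₀ * Real.exp δ + C₀ ≤ C * ((L ^ k : ℕ) : ℝ) ^ (-α) := by
      rw [hCdef]
      have h0 : 0 ≤ C₁ * ((L ^ k : ℕ) : ℝ) ^ (-α) := by positivity
      have h1 : C₀ * (1 + Real.exp δ) * 1 ≤ C₀ * (1 + Real.exp δ) * ((4 : ℝ) ^ α * ((L ^ k : ℕ) : ℝ) ^ (-α)) :=
        mul_le_mul_of_nonneg_left hrate (by positivity)
      nlinarith
    calc C₀ * Real.exp δ * Real.exp (-(δ * tdistT M y y')) + C₀ * Real.exp (-(δ * tdistT M y y'))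
        = (C₀ * Real.exp δ + C₀) * Real.exp (-(δ * tdistT M y y')) := by ring
      _ ≤ C * ((L ^ k : ℕ) : ℝ) ^ (-α) * Real.exp (-(δ * tdistT M y y')) := mul_le_mul_of_nonneg_right hle hE

/-- `T ∘ (Σ_ν S_ν pr_ν) = Σ_ν (T∘S_ν) pr_ν`. [folklore] -/
theorem comp_sumJ {X J : Type} [Fintype J] {F₂ F₃ : Type} [AddCommGroup F₂] [Module ℝ F₂] [AddCommGroup F₃] [Module ℝ F₃] (T : F₂ →ₗ[ℝ] F₃)
    (S : J → ((X → ℝ) →ₗ[ℝ] F₂)) : T ∘ₗ sumJ S = sumJ fun ν => T ∘ₗ S ν := by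
  rw [sumJ, sumJ, linearMap_comp_sum]
  refine Finset.sum_congr rfl fun ν _ => ?_
  rw [LinearMap.comp_assoc]

/-- the commutation bookkeeping `(S − 1)∘(C∘T) = (C⁺ − C)∘(S∘T) + C∘((S − 1)∘T)` when `S∘C = C⁺∘S`. [folklore] -/
theorem sub_id_comp_comp_eq {F₁ F₂ : Type} [AddCommGroup F₁] [Module ℝ F₁] [AddCommGroup F₂] [Module ℝ F₂] (S Ca Cap : F₂ →ₗ[ℝ] F₂) (T : F₁ →ₗ[ℝ] F₂)
    (h : S ∘ₗ Ca = Cap ∘ₗ S) :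
    (S - LinearMap.id) ∘ₗ (Ca ∘ₗ T) = (Cap - Ca) ∘ₗ (S ∘ₗ T) + Ca ∘ₗ ((S - LinearMap.id) ∘ₗ T) := by
  refine LinearMap.ext fun v => ?_
  have h1 := LinearMap.congr_fun h (T v)
  simp only [LinearMap.comp_apply] at h1
  simp only [LinearMap.comp_apply, LinearMap.sub_apply, LinearMap.add_apply, LinearMap.id_apply, map_sub, h1]
  abel

/-- ★★ **THE SHIFT-DEFECT LETTER AT BAŁABAN's FULL `U ≡ 1` PROPAGATOR.**  For odd `L ≥ 3`, `b > 0`, `0 ≤ α < 1` there are `δ, C > 0` such that, on the torus family of record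
(`M_μ = 2L^{m_T}`, coarse spacing `L^{−k}`, fine `L^{−m−k}`, King's pairing), for every direction `κ` and every coefficient operator `C_a` on the coarse 1-forms INTERTWINING the
coarse shift — `S_{+κ}∘C_a = C_a⁺∘S_{+κ}` with `C_a ≤ diagK a₀`, `C_a⁺ − C_a ≤ diagK o₁` (`a₀, o₁ ≥ 0`: the size and the one-coarse-step oscillation of the coefficient) — the
shift-defect row letter of `…Entry2Letters.hasMaj_idef_entry2_of_letters` holds with `Σ = Σ_ν (G∇_ν*) pr_ν`, `G = gOp`, `∇_ν* = fgradAdj (L^k) (bshiftEquiv ν)`: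
`𝔇(S′_{+κ}, S_{+κ})∘(C_a∘Σ) ≤ C·(o₁ + a₀·(L^k)^{−α})·e^{−δ|y−y′|_T}`.  The two-grid content: the defect of the shifts vanishes on the block face and is the one-step forward
difference inside (§3); `(S_{+κ} − 1)C_aΣ = (C_a⁺ − C_a)S_{+κ}Σ + C_a(S_{+κ} − 1)Σ`; the first term costs the oscillation letter, the second the Hölder step of `G∇*`
(`hasMaj_oneStepFwd_gDivAdj`). [cite: Balaban1984PropagatorsI, Prop. 1.2 (1.110)–(1.111) p.35; Balaban1985BackgroundPropagators, (3.64)–(3.65) p.402 (mechanism); King1986, p.664] -/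
theorem hasMaj_shiftDefect_fullG (hLodd : Odd L) (hL2 : 2 ≤ L) {b : ℝ} (hb : 0 < b) {α : ℝ} (hα0 : 0 ≤ α) (hα1 : α < 1) :
    ∃ δ C : ℝ, 0 < δ ∧ 0 < C ∧ ∀ (mT k m : ℕ) (_hk : 1 ≤ k) (hL : Odd L ∧ 1 < L) (κ : Fin (d + 1))
      (Ca Cap : (Tor (fine (L ^ k) (MP (paramsOf d L mT k hL))) × Fin (d + 1) → ℝ) →ₗ[ℝ] (Tor (fine (L ^ k) (MP (paramsOf d L mT k hL))) × Fin (d + 1) → ℝ))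
      (a₀ o₁ : ℝ), 0 ≤ a₀ → 0 ≤ o₁ →
      pull ⇑(bshiftEquiv (MP (paramsOf d L mT k hL)) (L ^ k) κ) ∘ₗ Ca = Cap ∘ₗ pull ⇑(bshiftEquiv (MP (paramsOf d L mT k hL)) (L ^ k) κ) →
      HasMaj (BlockNorm.ofBlocks (unitTorusGeo L k (MP (paramsOf d L mT k hL))) (blkFine L k (MP (paramsOf d L mT k hL))))
        (BlockNorm.ofBlocks (unitTorusGeo L k (MP (paramsOf d L mT k hL))) (blkFine L k (MP (paramsOf d L mT k hL)))) Ca (diagK fun _ => a₀) →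
      HasMaj (BlockNorm.ofBlocks (unitTorusGeo L k (MP (paramsOf d L mT k hL))) (blkFine L k (MP (paramsOf d L mT k hL))))
        (BlockNorm.ofBlocks (unitTorusGeo L k (MP (paramsOf d L mT k hL))) (blkFine L k (MP (paramsOf d L mT k hL)))) (Cap - Ca) (diagK fun _ => o₁) →
      HasMaj (BlockNorm.ofBlocks (unitTorusGeo L k (MP (paramsOf d L mT k hL))) (liftBlk (blkFine L k (MP (paramsOf d L mT k hL))) (Fin (d + 1))))
        (BlockNorm.ofBlocks (unitTorusGeo L k (MP (paramsOf d L mT k hL))) (blkFine L k (MP (paramsOf d L mT k hL)) ∘ kingPrV L k m (MP (paramsOf d L mT k hL))))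
        (idef (pull (kingPrV L k m (MP (paramsOf d L mT k hL)))) (pull (kingPrV L k m (MP (paramsOf d L mT k hL))))
            (pull ⇑(bshiftEquiv (MP (paramsOf d L mT k hL)) (L ^ m * L ^ k) κ)) (pull ⇑(bshiftEquiv (MP (paramsOf d L mT k hL)) (L ^ k) κ)) ∘ₗ
          (Ca ∘ₗ sumJ fun ν => gOp (MP (paramsOf d L mT k hL)) (L ^ k) b ∘ₗ fgradAdj ((L ^ k : ℕ) : ℝ) (bshiftEquiv (MP (paramsOf d L mT k hL)) (L ^ k) ν)))
        (fun y y' => C * (o₁ + a₀ * ((L ^ k : ℕ) : ℝ) ^ (-α)) * Real.exp (-(δ * tdistT (MP (paramsOf d L mT k hL)) y y'))) := by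
  have hL : Odd L ∧ 1 < L := ⟨hLodd, by omega⟩
  have hL0 : 0 < L := by omega
  obtain ⟨δ₁, C₁, hδ₁, hC₁, HH⟩ := hasMaj_oneStepFwd_gDivAdj (d := d) hLodd hL2 hb hα0 hα1
  obtain ⟨δ₀, C₀, Cα, Cε, Cαε, hδ₀, hC₀, HP⟩ := ineq110_114_pair (d := d) hL hb
  set δ : ℝ := min δ₀ δ₁ with hδdef
  have hδ : 0 < δ := lt_min hδ₀ hδ₁
  set C : ℝ := Real.exp δ * ((d + 1 : ℕ) * C₀) + (d + 1 : ℕ) * C₁ with hCdef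
  have hC : 0 < C := by positivity
  refine ⟨δ, C, hδ, hC, fun mT k m hk hL' κ Ca Cap a₀ o₁ ha₀ ho₁ hCaS hCa hOsc => ?_⟩
  have hn1 : 1 ≤ L ^ k := Nat.one_le_pow _ _ hL0
  have hnpos : (0 : ℝ) < ((L ^ k : ℕ) : ℝ) := by exact_mod_cast Nat.pos_of_ne_zero (by positivity)
  have hrα : 0 ≤ ((L ^ k : ℕ) : ℝ) ^ (-α) := Real.rpow_nonneg hnpos.le _
  -- the plain (1.110) majorant of the `S_ν = G∇_ν*` at the common rate, and of `Σ`, and of `S_{+κ}Σ`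
  obtain ⟨HP1, -⟩ := HP mT k m hk
  have hS : ∀ ν, HasMaj (BlockNorm.ofBlocks (unitTorusGeo L k (MP (paramsOf d L mT k hL'))) (blkFine L k (MP (paramsOf d L mT k hL'))))
      (BlockNorm.ofBlocks (unitTorusGeo L k (MP (paramsOf d L mT k hL'))) (blkFine L k (MP (paramsOf d L mT k hL'))))
      (gOp (MP (paramsOf d L mT k hL')) (L ^ k) b ∘ₗ fgradAdj ((L ^ k : ℕ) : ℝ) (bshiftEquiv (MP (paramsOf d L mT k hL')) (L ^ k) ν))
      (fun y y' => C₀ * Real.exp (-(δ * tdistT (MP (paramsOf d L mT k hL')) y y'))) := fun ν => by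
    rw [← symbOp_sTinv_sub_one_eq]
    exact hasMaj_rate_mono hC₀.le (min_le_left δ₀ δ₁) (hasMaj_gDivAdj_of_ineq (MP (paramsOf d L mT k hL')) k (L ^ k) b hn1 HP1 hC₀.le ν)
  have hSig := hasMaj_sumJ_exp (g := unitTorusGeo L k (MP (paramsOf d L mT k hL'))) (blkFine L k (MP (paramsOf d L mT k hL')))
    (b₂ := BlockNorm.ofBlocks (unitTorusGeo L k (MP (paramsOf d L mT k hL'))) (blkFine L k (MP (paramsOf d L mT k hL')))) hC₀.le hS
  have hSsig := hasMaj_fshift_comp (MP (paramsOf d L mT k hL')) k (L ^ k)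
    (b₁ := BlockNorm.ofBlocks (unitTorusGeo L k (MP (paramsOf d L mT k hL'))) (liftBlk (blkFine L k (MP (paramsOf d L mT k hL'))) (Fin (d + 1))))
    (mul_nonneg (Nat.cast_nonneg _) hC₀.le) hδ.le κ hSig
  -- term A: `(C_a⁺ − C_a) S Σ ≤ o₁·e^{δ}|J|C₀·e^{−δd}`
  have hA := hasMaj_diagK_comp_exp (b₁ := BlockNorm.ofBlocks (unitTorusGeo L k (MP (paramsOf d L mT k hL'))) (liftBlk (blkFine L k (MP (paramsOf d L mT k hL'))) (Fin (d + 1))))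
    (b₃ := BlockNorm.ofBlocks (unitTorusGeo L k (MP (paramsOf d L mT k hL'))) (blkFine L k (MP (paramsOf d L mT k hL')))) (blkFine L k (MP (paramsOf d L mT k hL')))
    ho₁ hOsc hSsig
  -- term B: `C_a (S − 1) Σ ≤ a₀·|J|C₁(L^k)^{−α}·e^{−δd}`
  have hstep : ∀ ν, HasMaj (BlockNorm.ofBlocks (unitTorusGeo L k (MP (paramsOf d L mT k hL'))) (blkFine L k (MP (paramsOf d L mT k hL'))))
      (BlockNorm.ofBlocks (unitTorusGeo L k (MP (paramsOf d L mT k hL'))) (blkFine L k (MP (paramsOf d L mT k hL'))))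
      ((pull ⇑(bshiftEquiv (MP (paramsOf d L mT k hL')) (L ^ k) κ) - LinearMap.id) ∘ₗ
        (gOp (MP (paramsOf d L mT k hL')) (L ^ k) b ∘ₗ fgradAdj ((L ^ k : ℕ) : ℝ) (bshiftEquiv (MP (paramsOf d L mT k hL')) (L ^ k) ν)))
      (fun y y' => C₁ * ((L ^ k : ℕ) : ℝ) ^ (-α) * Real.exp (-(δ * tdistT (MP (paramsOf d L mT k hL')) y y'))) := fun ν =>
    hasMaj_rate_mono (mul_nonneg hC₁.le hrα) (min_le_right δ₀ δ₁) (HH mT k m hk hL' κ ν)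
  have hSig' := hasMaj_sumJ_exp (g := unitTorusGeo L k (MP (paramsOf d L mT k hL'))) (blkFine L k (MP (paramsOf d L mT k hL')))
    (b₂ := BlockNorm.ofBlocks (unitTorusGeo L k (MP (paramsOf d L mT k hL'))) (blkFine L k (MP (paramsOf d L mT k hL')))) (mul_nonneg hC₁.le hrα) hstep
  have hSig'' := hSig'.congr fun u => (LinearMap.congr_fun (comp_sumJ (pull ⇑(bshiftEquiv (MP (paramsOf d L mT k hL')) (L ^ k) κ) - LinearMap.id)
    (fun ν => gOp (MP (paramsOf d L mT k hL')) (L ^ k) b ∘ₗ fgradAdj ((L ^ k : ℕ) : ℝ) (bshiftEquiv (MP (paramsOf d L mT k hL')) (L ^ k) ν))) u).symm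
  have hB := hasMaj_diagK_comp_exp (b₁ := BlockNorm.ofBlocks (unitTorusGeo L k (MP (paramsOf d L mT k hL'))) (liftBlk (blkFine L k (MP (paramsOf d L mT k hL'))) (Fin (d + 1))))
    (b₃ := BlockNorm.ofBlocks (unitTorusGeo L k (MP (paramsOf d L mT k hL'))) (blkFine L k (MP (paramsOf d L mT k hL')))) (blkFine L k (MP (paramsOf d L mT k hL')))
    ha₀ hCa hSig''
  have hkey : o₁ * (((Fintype.card (Fin (d + 1)) : ℕ) : ℝ) * C₀ * Real.exp δ) + a₀ * (((Fintype.card (Fin (d + 1)) : ℕ) : ℝ) * (C₁ * ((L ^ k : ℕ) : ℝ) ^ (-α))) ≤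
      C * (o₁ + a₀ * ((L ^ k : ℕ) : ℝ) ^ (-α)) := by
    rw [Fintype.card_fin, hCdef]
    have h1 : 0 ≤ ((d + 1 : ℕ) : ℝ) * C₁ * o₁ := by positivity
    have h2 : 0 ≤ Real.exp δ * (((d + 1 : ℕ) : ℝ) * C₀) * (a₀ * ((L ^ k : ℕ) : ℝ) ^ (-α)) := by positivity
    nlinarith
  have hsum := (hasMaj_add_exp hA hB).mono fun y y' =>
    (mul_le_mul_of_nonneg_right hkey (Real.exp_nonneg (-(δ * tdistT (MP (paramsOf d L mT k hL')) y y'))))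
  -- the device: it suffices to majorise `(S_{+κ} − 1) ∘ (C_a ∘ Σ) = (C_a⁺ − C_a)S_{+κ}Σ + C_a(S_{+κ} − 1)Σ`
  refine hasMaj_idefFShift_comp (MP (paramsOf d L mT k hL')) k m
    (b₁ := BlockNorm.ofBlocks (unitTorusGeo L k (MP (paramsOf d L mT k hL'))) (liftBlk (blkFine L k (MP (paramsOf d L mT k hL'))) (Fin (d + 1))))
    (fun _ _ => mul_nonneg (mul_nonneg hC.le (by positivity)) (Real.exp_nonneg _)) κ
    -- the operator identity `(S − 1)∘(C_a∘Σ) = (C_a⁺ − C_a)∘(S∘Σ) + C_a∘((S − 1)∘Σ)`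
    (hsum.congr fun u => (LinearMap.congr_fun (sub_id_comp_comp_eq _ Ca Cap _ hCaS) u).symm)

end FullG

end Summit.QuantumFields.YangMills.BalabanUVNodes.N15.BackgroundLayer

end
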